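import Mathlib
import Summits.Ventures.HodgeRepro2.T5SelfDualGaussSum
import Summits.Ventures.HodgeRepro2.T5LocalFieldHaar

/-!
# Volumes under the self-dual measure: `vol(𝒪) = q^{−ν/2}`, `vol(𝔭^n) = vol(1 + 𝔭^n) = q^{−ν/2−n}`, `vol(𝒪^×) = q^{−ν/2}(1 − q⁻¹)`

Blind cell `pub-hodge-repro2`, seat p7 (gen 9), Tier-5 kernel support for N5 / §G [R-4]
(route/T5-route-3.md §AA.1(b)(iii): «with dy the SELF-DUAL measure of ψ_w … vol(1 + 𝔭^c) =
q^{−ν/2}·vol₀(O^×)/[O^× : 1 + 𝔭^c] = q^{−ν/2}·(1 − q^{−1})/(q^{c−1}(q − 1)) = q^{−ν/2}·q^{−c}»;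
§Y.1(b) «vol O^× = 1 − q^{−1}»).

`T5SelfDualGaussSum.selfDualScaled μ q ν = q^{−ν/2} • μ` is the self-dual scaling of a Haar
probability measure `μ`; on Mathlib's local-field object with `μ = haar 𝒪[K]` (rows 29 / 29′)
the volumes in §AA.1(b)(iii) are:

* `selfDualScaled_apply`: `vol_ν(s) = q^{−ν/2} · vol(s)` for every set;
* `selfDualScaled_span_pow`: `vol_ν(𝔭^n) = q^{−ν/2} · q^{−n}`;
* `selfDualScaled_coset_one_add`: `vol_ν(1 + 𝔭^n) = q^{−ν/2} · q^{−n}` — the displayed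
  `vol(1 + 𝔭^c) = q^{−ν/2}·q^{−c}`;
* `selfDualScaled_setOf_isUnit`: `vol_ν(𝒪^×) = q^{−ν/2} · (1 − q⁻¹)`.

(`q^{−ν/2}` is written `ENNReal.ofReal (√(q^ν))⁻¹`, as in the definition of `selfDualScaled`.)
Stays prose: that the scaled measure IS the self-dual measure of a `ψ_v` of conductor `𝔭^{−ν}`
(Kudla (3.29)).  README §8(d): uses an L-value-free non-vanishing device: NO.
-/

namespace Summit.Ventures.HodgeRepro2.T5SelfDualVolume

open MeasureTheory Ideal
open Summit.Ventures.HodgeRepro2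
open scoped NormedField Valued ENNReal

section Abstract

variable {𝒪 : Type*} [MeasurableSpace 𝒪] (μ : Measure 𝒪)

/-- `vol_ν(s) = q^{−ν/2} · vol(s)`. -/
theorem selfDualScaled_apply (q : ℝ) (ν : ℕ) (s : Set 𝒪) :
    T5SelfDualGaussSum.selfDualScaled μ q ν s = ENNReal.ofReal (Real.sqrt (q ^ ν))⁻¹ * μ s := by
  simp [T5SelfDualGaussSum.selfDualScaled]

end Abstract

section LocalField

variable {K : Type*} [NontriviallyNormedField K] [IsUltrametricDist K] [CompleteSpace K]
  [IsDiscreteValuationRing 𝒪[K]] [Finite 𝓀[K]] [MeasurableSpace K] [BorelSpace K] {ϖ : 𝒪[K]}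

/-- `vol_ν(𝒪[K]) = q^{−ν/2}` (`vol(𝒪) = 1` for `haar`). -/
theorem selfDualScaled_univ (q : ℝ) (ν : ℕ) :
    T5SelfDualGaussSum.selfDualScaled (T5LocalFieldHaar.haar (K := K)) q ν Set.univ =
      ENNReal.ofReal (Real.sqrt (q ^ ν))⁻¹ :=
  T5SelfDualGaussSum.selfDualScaled_univ _ q ν

/-- `vol_ν(𝔭^n) = q^{−ν/2} · q^{−n}` (`q = |𝓀[K]|`). -/
theorem selfDualScaled_span_pow (hϖ : Irreducible ϖ) (ν n : ℕ) :
    T5SelfDualGaussSum.selfDualScaled (T5LocalFieldHaar.haar (K := K)) (Nat.card 𝓀[K] : ℝ) ν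
        ((span {ϖ ^ n} : Ideal 𝒪[K]) : Set 𝒪[K]) =
      ENNReal.ofReal (Real.sqrt ((Nat.card 𝓀[K] : ℝ) ^ ν))⁻¹ * ((Nat.card 𝓀[K] : ℝ≥0∞) ^ n)⁻¹ := by
  rw [selfDualScaled_apply, T5LocalFieldHaar.haarProb_span_pow_eq_inv_pow hϖ n]

/-- `vol_ν(1 + 𝔭^n) = q^{−ν/2} · q^{−n}`: §AA.1(b)(iii)'s `vol(1 + 𝔭^c) = q^{−ν/2}·q^{−c}`. -/
theorem selfDualScaled_coset_one_add (hϖ : Irreducible ϖ) (ν n : ℕ) :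
    T5SelfDualGaussSum.selfDualScaled (T5LocalFieldHaar.haar (K := K)) (Nat.card 𝓀[K] : ℝ) ν
        {x : 𝒪[K] | x - 1 ∈ (span {ϖ ^ n} : Ideal 𝒪[K])} =
      ENNReal.ofReal (Real.sqrt ((Nat.card 𝓀[K] : ℝ) ^ ν))⁻¹ * ((Nat.card 𝓀[K] : ℝ≥0∞) ^ n)⁻¹ := by
  rw [selfDualScaled_apply, T5LocalFieldHaar.haarProb_coset_one_add_eq_inv_pow hϖ n]

/-- `vol_ν(𝒪[K]ˣ) = q^{−ν/2} · (1 − q⁻¹)`: §Y.1(b)'s `vol O^× = 1 − q^{−1}` in the self-dual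
normalisation. -/
theorem selfDualScaled_setOf_isUnit (hϖ : Irreducible ϖ) (ν : ℕ) :
    T5SelfDualGaussSum.selfDualScaled (T5LocalFieldHaar.haar (K := K)) (Nat.card 𝓀[K] : ℝ) ν
        {x : 𝒪[K] | IsUnit x} =
      ENNReal.ofReal (Real.sqrt ((Nat.card 𝓀[K] : ℝ) ^ ν))⁻¹ *
        (1 - ((Nat.card 𝓀[K] : ℝ≥0∞))⁻¹) := by
  rw [selfDualScaled_apply, T5LocalFieldHaar.haarProb_setOf_isUnit hϖ]

end LocalField

end Summit.Ventures.HodgeRepro2.T5SelfDualVolume
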